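import Mathlib
import HarnessLib
import Summits.Ventures.LatticeQCDFlow.Exactness.SUNMetropolisORSweepErgodic
import Summits.Ventures.LatticeQCDFlow.Scoring.CabibboMarinariSweepBatchMeans
import Summits.Ventures.LatticeQCDFlow.Scoring.DoeblinPowerBatchMeansTauInt

/-!
# The engine's `'hb' (Cabibbo–Marinari) + n_or × 'or'` composite on `SU(N)` as run: its one-step Doeblin certificate, and what it buys — every event a finite `τ_int`, a certified burn-in `B/n`, the CLT and asymptotically exact batch-means error bars from EVERY start

HONEST FRAMING: exact (Metropolis-corrected) sampling algorithms for lattice gauge theory;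
figures of merit are autocorrelation/cost numbers at stated couplings and volumes; no
continuum-physics claim.

Venture `LatticeQCDFlow` (cell pub-lqcd), topic `Exactness`, FANOUT row 9 (eng-latcore, GEN-23; the engine
`latflow.core.updates.composite_sweep(f, β, 'hb', n_or)` for `SU(N)`: one sweep of Cabibbo–Marinari `SU(2)`-subgroup
heat baths over all coordinate pairs and every link, then `n_or` Cabibbo–Marinari over-relaxation sweeps).  NEW
WORK of the cell over the tree, nothing cited as a fact, no number claimed: gen-10's
`CabibboMarinariLatticeErgodic.lean` (`latSweep`, `latSweep_minorised` — ONE-STEP `ε · Haar^{⊗E} ≤ K(ω, ·)`,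
`latSweep_invariant_piGibbsLaw`, `isMarkovKernel_latSweep`), gen-17's `CabibboMarinariORSweep.lean` (`cmORSweep`),
gen-21's `SUNMetropolisORSweepErgodic.lean` (`cmORSweep_invariant_gibbsProbability`), `RefreshScan.lean`
(`minorised_comp_left`), `WilsonHeatBathErgodic.lean` (`wilsonMeasure_eq_piGibbsLaw`), row 8's
`Scoring/CabibboMarinariSweepBatchMeans.lean` (`wilson_gibbsDensity_pinched`; its NOT-CLAIMED list names exactly
this composite: "covered by `Scoring/DoeblinPowerBatchMeans.lean` once its certificate is supplied"), row 13's /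
row 8's `…_of_nHit` theorems.  Printed counterparts NAMED ONLY: Cabibbo–Marinari 1982; Kennedy–Pendleton 1985;
Creutz 1987 / Brown–Woch 1987 (over-relaxation); Meyn–Tweedie 1993; Flegal–Jones 2010; Madras–Sokal 1988.

## Content (torus `(ℤ/L)^d`, `L ≥ 2`, `G = SU(N)` in the defining representation `suRep N`, `N ≥ 1`, any real
## `β`; frames through all coordinate pairs (lexicographic or reversed), `links` containing every link, ANY OR
## schedule `sched`; `K = cmORSweep sched ∘ₖ latSweep (gibbsDensity (β S_W)) frames links`, `π = wilsonMeasure (suRep N) β`)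

* §1 generic: **`minorised_exactStep_of_target`** — if `ε • π ≤ κ(a, ·)` for all `a` and `P` leaves `π`
  invariant, then `ε • π ≤ (P ∘ₖ κ)(a, ·)` for all `a`; **`smul_piGibbsLaw_le_pi`** — the product reference law
  dominates `(Z · M⁻¹) ·` the normalised Gibbs law of a density `p ≤ M`.
* §2 **`wilson_cmSweep_orSweep_certificate`** — `K` leaves `π` invariant and `ε' • π ≤ K(U, ·) = K^1(U, ·)` for
  EVERY `U`, `0 < ε' ≤ 1` (ONE step: the heat-bath sweep forgets its start with probability `ε'` per sweep).
* §3 **`wilson_cmSweep_orSweep_tauInt_setACF_le`** (ONE `B ≥ 0`: `τ_int(1_A) ≤ 1/2 + B/(1 − π(A))` for EVERY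
  event), **`wilson_cmSweep_orSweep_timeAverage_bias_le`** (burn-in `B/n` from EVERY start),
  **`wilson_cmSweep_orSweep_timeAverage_clt`**, **`wilson_cmSweep_orSweep_batchMeans_tendstoInMeasure`**,
  **`wilson_cmSweep_orSweep_batchMeans_coverage`** (`σ²_f > 0`), **`wilson_cmSweep_orSweep_tauInt_tendstoInMeasure`**
  (`Var_π f ≠ 0`) — every bounded measurable `f`, EVERY initial law.

NOT CLAIMED: any value of `ε', B`; the `SU(2)` engine path with the DIRECT Creutz / Kennedy–Pendleton link heat
bath (the true link heat bath + OR: `SU2HeatBathORSweep.lean`; its certificate is the same argument, not written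
here); the capped loops as coded (`SU2HeatBathCapped.lean` / `KernelTVPerturbation.lean` quantify that
perturbation); floating point and the engine's `k ≤ 10⁻¹²` OR skip.
-/

noncomputable section

namespace Summit.Ventures.LatticeQCDFlow.Exactness

open MeasureTheory Measure Set Filter Topology Function ProbabilityTheory ProbabilityTheory.Kernel
open Literature.MathematicalPhysics.QuantumFieldTheory
open Summit.Ventures.LatticeQCDFlow.Scoring (replicaSEsq tauInt autocov kop)
open scoped ENNReal

/-! ## §1 Two generic comparisons -/

section Generic

variable {α : Type*} [MeasurableSpace α]

/-- **A kernel minorised by its own target, followed by ANY exact step, is minorised by the target with the same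
constant**: `ε • π ≤ κ(a, ·)` for all `a` and `π P = π` give `ε • π ≤ (P ∘ₖ κ)(a, ·)` for all `a`. -/
theorem minorised_exactStep_of_target {κ : Kernel α α} {π : Measure α} {ε : ℝ≥0∞} (h : ∀ a, ε • π ≤ κ a)
    (P : Kernel α α) (hP : Kernel.Invariant P π) : ∀ a, ε • π ≤ (P ∘ₖ κ) a := fun a => by
  have h2 := minorised_comp_left h P a
  rwa [hP.def] at h2

variable {ι : Type*} [Fintype ι] {X : ι → Type*} [∀ i, MeasurableSpace (X i)]
  {μ : Π i, Measure (X i)} {p : (Π j, X j) → ℝ≥0∞} {M : ℝ≥0∞}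

/-- **The product reference law dominates a multiple of the normalised Gibbs law**: for a density `p ≤ M`
(`M ≠ 0, ∞`) with `Z = ∫ p d⊗μ ≠ 0, ∞`: `(Z · M⁻¹) • piGibbsLaw μ p ≤ ⊗μ`. -/
theorem smul_piGibbsLaw_le_pi (hM0 : M ≠ 0) (hMtop : M ≠ ∞) (hpM : ∀ ω, p ω ≤ M)
    (hZ0 : ∫⁻ ω, p ω ∂Measure.pi μ ≠ 0) (hZtop : ∫⁻ ω, p ω ∂Measure.pi μ ≠ ∞) :
    ((∫⁻ ω, p ω ∂Measure.pi μ) * M⁻¹) • piGibbsLaw μ p ≤ Measure.pi μ := by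
  rw [piGibbsLaw, smul_smul, mul_comm (∫⁻ ω, p ω ∂Measure.pi μ) M⁻¹, mul_assoc,
    ENNReal.mul_inv_cancel hZ0 hZtop, mul_one]
  refine Measure.le_iff.2 fun s hs => ?_
  rw [Measure.smul_apply, smul_eq_mul, withDensity_apply _ hs]
  calc M⁻¹ * ∫⁻ x in s, p x ∂Measure.pi μ ≤ M⁻¹ * ∫⁻ _ in s, M ∂Measure.pi μ :=
        mul_le_mul' le_rfl (lintegral_mono fun ω => hpM ω)
    _ = Measure.pi μ s := by
        rw [MeasureTheory.setLIntegral_const, ← mul_assoc, ENNReal.inv_mul_cancel hM0 hMtop, one_mul]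

end Generic

/-! ## §2 The certificate of the engine's `'hb' (Cabibbo–Marinari) + n_or × 'or'` composite -/

section CMOR

variable (N : ℕ) [NeZero N] {d L : ℕ} {m : Type*} [Fintype m] [DecidableEq m]

/-- **THE ONE-STEP DOEBLIN CERTIFICATE OF THE ENGINE'S `'hb' + n_or × 'or'` COMPOSITE ON `SU(N)` AS RUN** (`L ≥ 2`,
any `β`; frames through all coordinate pairs, every link visited, ANY OR schedule): the composite leaves
`wilsonMeasure (suRep N) β` invariant and dominates `ε' · wilsonMeasure (suRep N) β` from EVERY configuration in
ONE step (`K^1 = K`), `0 < ε' ≤ 1`. -/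
theorem wilson_cmSweep_orSweep_certificate [NeZero L] (hL : 2 ≤ L) (β : ℝ) (frames : List (Fin N ≃ Fin 2 ⊕ m))
    (hlex : frames.map pairOf = lexPairs (Finset.univ.sort (· ≤ ·) : List (Fin N)) ∨
      frames.map pairOf = (lexPairs (Finset.univ.sort (· ≤ ·) : List (Fin N))).reverse)
    {links : List (Edge d L)} (hl : ∀ e, e ∈ links) (sched : List (Edge d L × (Fin N ≃ Fin 2 ⊕ m))) :
    Invariant (cmORSweep sched ∘ₖ
                latSweep (gibbsDensity fun U : GaugeConfig d L (Matrix.specialUnitaryGroup (Fin N) ℂ) => β * wilsonAction (suRep N) U) frames links)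
        (wilsonMeasure (d := d) (L := L) (suRep N) β) ∧
      ∃ ε' : ℝ≥0∞, 0 < ε' ∧ ε' ≤ 1 ∧ ∀ U : GaugeConfig d L (Matrix.specialUnitaryGroup (Fin N) ℂ),
        ε' • wilsonMeasure (d := d) (L := L) (suRep N) β ≤
          nHit (cmORSweep sched ∘ₖ
                latSweep (gibbsDensity fun U : GaugeConfig d L (Matrix.specialUnitaryGroup (Fin N) ℂ) => β * wilsonAction (suRep N) U) frames links) 1 U := by
  obtain ⟨mlo, Mhi, hm0, hMtop, hp, hmp, hpM⟩ :=
    Scoring.wilson_gibbsDensity_pinched (d := d) (L := L) (suRep N) continuous_suRep β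
  haveI := isMarkovKernel_latSweep hp hm0 hMtop hmp hpM frames links
  haveI : IsProbabilityMeasure (wilsonMeasure (d := d) (L := L) (suRep N) β) := isProbabilityMeasure_wilsonMeasure _ continuous_suRep β
  -- exactness of both factors for the Wilson measure
  have hHB : Invariant (latSweep (gibbsDensity fun U : GaugeConfig d L (Matrix.specialUnitaryGroup (Fin N) ℂ) => β * wilsonAction (suRep N) U) frames links) (wilsonMeasure (d := d) (L := L) (suRep N) β) := by
    rw [wilsonMeasure_eq_piGibbsLaw]
    exact latSweep_invariant_piGibbsLaw hp hm0 hMtop hmp hpM frames links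
  have hOR : Invariant (cmORSweep (d := d) (L := L) sched) (wilsonMeasure (d := d) (L := L) (suRep N) β) := by
    rw [← gibbsProbability_eq_wilsonMeasure]
    exact cmORSweep_invariant_gibbsProbability N hL β sched
  -- the heat-bath sweep dominates `ε ·` product Haar, which dominates a multiple of the Wilson measure
  obtain ⟨ε, hε, hmin⟩ := latSweep_minorised hp hm0 hMtop hmp hpM frames hlex hl
  set Z : ℝ≥0∞ := ∫⁻ ω, gibbsDensity (fun U : GaugeConfig d L (Matrix.specialUnitaryGroup (Fin N) ℂ) => β * wilsonAction (suRep N) U) ω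
    ∂Measure.pi (linkHaar (Edge d L) (Fin N)) with hZ
  have hZlo : mlo ≤ Z := by
    calc mlo = ∫⁻ _, mlo ∂Measure.pi (linkHaar (Edge d L) (Fin N)) := by rw [MeasureTheory.lintegral_const, measure_univ, mul_one]
      _ ≤ Z := lintegral_mono fun ω => hmp ω
  have hZhi : Z ≤ Mhi := by
    calc Z ≤ ∫⁻ _, Mhi ∂Measure.pi (linkHaar (Edge d L) (Fin N)) := lintegral_mono fun ω => hpM ω
      _ = Mhi := by rw [MeasureTheory.lintegral_const, measure_univ, mul_one]
  have hZ0 : Z ≠ 0 := (lt_of_lt_of_le (pos_iff_ne_zero.2 hm0) hZlo).ne'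
  have hZtop : Z ≠ ∞ := ne_top_of_le_ne_top hMtop hZhi
  have hM0 : Mhi ≠ 0 := (lt_of_lt_of_le (pos_iff_ne_zero.2 hm0) ((hmp 1).trans (hpM 1))).ne'
  have hcmp : (Z * Mhi⁻¹) • (wilsonMeasure (d := d) (L := L) (suRep N) β) ≤ Measure.pi (linkHaar (Edge d L) (Fin N)) := by
    rw [wilsonMeasure_eq_piGibbsLaw]
    exact smul_piGibbsLaw_le_pi hM0 hMtop hpM hZ0 hZtop
  have hminW : ∀ U : GaugeConfig d L (Matrix.specialUnitaryGroup (Fin N) ℂ), (ε * (Z * Mhi⁻¹)) • (wilsonMeasure (d := d) (L := L) (suRep N) β) ≤ latSweep (gibbsDensity fun U : GaugeConfig d L (Matrix.specialUnitaryGroup (Fin N) ℂ) => β * wilsonAction (suRep N) U) frames links U := fun U => by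
    rw [← smul_smul]
    refine le_trans ?_ (hmin U)
    refine Measure.le_iff'.2 fun A => ?_
    simp only [Measure.smul_apply, smul_eq_mul]
    exact mul_le_mul' le_rfl (Measure.le_iff'.1 hcmp A)
  have hcomp := minorised_exactStep_of_target hminW (cmORSweep sched) hOR
  have hε'0 : ε * (Z * Mhi⁻¹) ≠ 0 := mul_ne_zero hε (mul_ne_zero hZ0 (ENNReal.inv_ne_zero.2 hMtop))
  have hε'1 : ε * (Z * Mhi⁻¹) ≤ 1 := by
    have h1 := Measure.le_iff'.1 (hcomp 1) univ
    rwa [Measure.smul_apply, smul_eq_mul, measure_univ, measure_univ, mul_one] at h1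
  refine ⟨hOR.comp hHB, ε * (Z * Mhi⁻¹), pos_iff_ne_zero.2 hε'0, hε'1, fun U => ?_⟩
  rw [GeneralNCMC.nHit_one]
  exact hcomp U

/-! ## §3 Figures of merit: `τ_int` of every event, burn-in, CLT, batch means, coverage, `τ̂_int` -/

/-- **EVERY EVENT HAS A FINITE `τ_int` UNDER THE ENGINE'S `'hb' + n_or × 'or'` COMPOSITE — ONE CONSTANT FOR ALL
EVENTS**: `B ≥ 0` with `τ_int(1_A) ≤ 1/2 + B/(1 − π(A))` (scorers' `Scoring.tauInt`) for EVERY measurable `A` with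
`0 < π(A) < 1`. -/
theorem wilson_cmSweep_orSweep_tauInt_setACF_le [NeZero L] (hL : 2 ≤ L) (β : ℝ) (frames : List (Fin N ≃ Fin 2 ⊕ m))
    (hlex : frames.map pairOf = lexPairs (Finset.univ.sort (· ≤ ·) : List (Fin N)) ∨
      frames.map pairOf = (lexPairs (Finset.univ.sort (· ≤ ·) : List (Fin N))).reverse)
    {links : List (Edge d L)} (hl : ∀ e, e ∈ links) (sched : List (Edge d L × (Fin N ≃ Fin 2 ⊕ m))) :
    ∃ B : ℝ, 0 ≤ B ∧ ∀ A : Set (GaugeConfig d L (Matrix.specialUnitaryGroup (Fin N) ℂ)), MeasurableSet A →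
      0 < (wilsonMeasure (d := d) (L := L) (suRep N) β).real A → (wilsonMeasure (d := d) (L := L) (suRep N) β).real A < 1 →
      tauInt (setACF (cmORSweep sched ∘ₖ
                latSweep (gibbsDensity fun U : GaugeConfig d L (Matrix.specialUnitaryGroup (Fin N) ℂ) => β * wilsonAction (suRep N) U) frames links)
          (wilsonMeasure (d := d) (L := L) (suRep N) β) A) ≤
        1 / 2 + B / (1 - (wilsonMeasure (d := d) (L := L) (suRep N) β).real A) := by
  haveI : IsProbabilityMeasure (wilsonMeasure (d := d) (L := L) (suRep N) β) := isProbabilityMeasure_wilsonMeasure _ continuous_suRep β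
  obtain ⟨mlo, Mhi, hm0, hMtop, hp, hmp, hpM⟩ :=
    Scoring.wilson_gibbsDensity_pinched (d := d) (L := L) (suRep N) continuous_suRep β
  haveI := isMarkovKernel_latSweep hp hm0 hMtop hmp hpM frames links
  obtain ⟨hinv, ε', hε0, hε1, hmin⟩ := wilson_cmSweep_orSweep_certificate N (d := d) hL β frames hlex hl sched
  have he0 : 0 < ε'.toReal := ENNReal.toReal_pos hε0.ne' (ne_top_of_le_ne_top ENNReal.one_ne_top hε1)
  have he1 : ε'.toReal ≤ 1 := ENNReal.toReal_le_of_le_ofReal zero_le_one (by simpa using hε1)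
  refine ⟨1 / ε'.toReal - 1, ?_, fun A hA h0 h1 => ?_⟩
  · rw [sub_nonneg, le_div_iff₀ he0]; nlinarith
  · simpa using GeneralNCMC.tauInt_setACF_le_of_nHit (GeneralNCMC.minorised_setwise hmin) hε0 hε1
      Nat.one_pos hinv hA h0 h1

/-- **CERTIFIED BURN-IN OF THE `'hb' + n_or × 'or'` COMPOSITE FROM EVERY START**: one `B ≥ 0` with
`|E_{μ₀}[(1/n) Σ_{t<n} g(U_t)] − ∫ g dπ| ≤ B/n` for EVERY initial law, every `[0,1]`-valued measurable `g`, `n ≥ 1`. -/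
theorem wilson_cmSweep_orSweep_timeAverage_bias_le [NeZero L] (hL : 2 ≤ L) (β : ℝ) (frames : List (Fin N ≃ Fin 2 ⊕ m))
    (hlex : frames.map pairOf = lexPairs (Finset.univ.sort (· ≤ ·) : List (Fin N)) ∨
      frames.map pairOf = (lexPairs (Finset.univ.sort (· ≤ ·) : List (Fin N))).reverse)
    {links : List (Edge d L)} (hl : ∀ e, e ∈ links) (sched : List (Edge d L × (Fin N ≃ Fin 2 ⊕ m)))
    [IsMarkovKernel (latSweep (gibbsDensity fun U : GaugeConfig d L (Matrix.specialUnitaryGroup (Fin N) ℂ) => β * wilsonAction (suRep N) U) frames links)] :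
    ∃ B : ℝ, 0 ≤ B ∧ ∀ (μ₀ : Measure (GaugeConfig d L (Matrix.specialUnitaryGroup (Fin N) ℂ))) [IsProbabilityMeasure μ₀]
      (g : GaugeConfig d L (Matrix.specialUnitaryGroup (Fin N) ℂ) → ℝ), Measurable g → (∀ U, 0 ≤ g U) → (∀ U, g U ≤ 1) →
      ∀ n : ℕ, n ≠ 0 →
      |∫ x, (∑ t ∈ Finset.range n, g (x t)) / n
          ∂(Kernel.trajMeasure (X := fun _ : ℕ => GaugeConfig d L (Matrix.specialUnitaryGroup (Fin N) ℂ)) μ₀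
              (fun t : ℕ => (cmORSweep sched ∘ₖ
                latSweep (gibbsDensity fun U : GaugeConfig d L (Matrix.specialUnitaryGroup (Fin N) ℂ) => β * wilsonAction (suRep N) U) frames links).comap
                (fun h : (i : ↥(Finset.Iic t)) → GaugeConfig d L (Matrix.specialUnitaryGroup (Fin N) ℂ) =>
                  h ⟨t, Finset.mem_Iic.2 le_rfl⟩) (measurable_pi_apply _)))
        - ∫ U, g U ∂(wilsonMeasure (d := d) (L := L) (suRep N) β)| ≤ B / n := by
  haveI : IsProbabilityMeasure (wilsonMeasure (d := d) (L := L) (suRep N) β) := isProbabilityMeasure_wilsonMeasure _ continuous_suRep β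
  obtain ⟨hinv, ε', hε0, hε1, hmin⟩ := wilson_cmSweep_orSweep_certificate N (d := d) hL β frames hlex hl sched
  have he0 : 0 < ε'.toReal := ENNReal.toReal_pos hε0.ne' (ne_top_of_le_ne_top ENNReal.one_ne_top hε1)
  refine ⟨1 / ε'.toReal, by positivity, fun μ₀ _ g hg h0 h1 n hn0 => ?_⟩
  calc _ ≤ ((1 : ℕ) : ℝ) / (ε'.toReal * n) :=
        GeneralNCMC.chain_timeAverage_bias_le_of_nHit (GeneralNCMC.minorised_setwise hmin) hε0 hε1 Nat.one_pos
          hinv μ₀ hg h0 h1 hn0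
    _ = 1 / ε'.toReal / n := by rw [Nat.cast_one, div_div]

/-- **THE CLT FOR TIME AVERAGES OF THE `'hb' + n_or × 'or'` COMPOSITE, FROM EVERY INITIAL LAW** (`|f| ≤ C`
measurable, `Y ~ N(0, σ²_f)`): `(√n)⁻¹ Σ_{t<n} (f(U_t) − π f) ⇒ Y` under `P_{μ₀}`. -/
theorem wilson_cmSweep_orSweep_timeAverage_clt [NeZero L] (hL : 2 ≤ L) (β : ℝ) (frames : List (Fin N ≃ Fin 2 ⊕ m))
    (hlex : frames.map pairOf = lexPairs (Finset.univ.sort (· ≤ ·) : List (Fin N)) ∨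
      frames.map pairOf = (lexPairs (Finset.univ.sort (· ≤ ·) : List (Fin N))).reverse)
    {links : List (Edge d L)} (hl : ∀ e, e ∈ links) (sched : List (Edge d L × (Fin N ≃ Fin 2 ⊕ m)))
    [IsMarkovKernel (latSweep (gibbsDensity fun U : GaugeConfig d L (Matrix.specialUnitaryGroup (Fin N) ℂ) => β * wilsonAction (suRep N) U) frames links)]
    {f : GaugeConfig d L (Matrix.specialUnitaryGroup (Fin N) ℂ) → ℝ} (hf : Measurable f) {C : ℝ} (hC : ∀ U, |f U| ≤ C)
    (μ₀ : Measure (GaugeConfig d L (Matrix.specialUnitaryGroup (Fin N) ℂ))) [IsProbabilityMeasure μ₀]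
    [IsProbabilityMeasure (Kernel.trajMeasure (X := fun _ : ℕ => GaugeConfig d L (Matrix.specialUnitaryGroup (Fin N) ℂ)) μ₀
              (fun t : ℕ => (cmORSweep sched ∘ₖ
                latSweep (gibbsDensity fun U : GaugeConfig d L (Matrix.specialUnitaryGroup (Fin N) ℂ) => β * wilsonAction (suRep N) U) frames links).comap
                (fun h : (i : ↥(Finset.Iic t)) → GaugeConfig d L (Matrix.specialUnitaryGroup (Fin N) ℂ) =>
                  h ⟨t, Finset.mem_Iic.2 le_rfl⟩) (measurable_pi_apply _)))]
    {Ω' : Type*} [MeasurableSpace Ω'] {P' : Measure Ω'} [IsProbabilityMeasure P'] {Y : Ω' → ℝ}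
    (hY : HasLaw Y (gaussianReal 0 (Real.toNNReal
      ((∫ y, (f y - ∫ z, f z ∂(wilsonMeasure (d := d) (L := L) (suRep N) β)) ^ 2 ∂(wilsonMeasure (d := d) (L := L) (suRep N) β))
              + 2 * ∑' k, ∫ y, (f y - ∫ z, f z ∂(wilsonMeasure (d := d) (L := L) (suRep N) β))
                * (kop (cmORSweep sched ∘ₖ
                latSweep (gibbsDensity fun U : GaugeConfig d L (Matrix.specialUnitaryGroup (Fin N) ℂ) => β * wilsonAction (suRep N) U) frames links))^[k + 1]
                  (fun y => f y - ∫ z, f z ∂(wilsonMeasure (d := d) (L := L) (suRep N) β)) y ∂(wilsonMeasure (d := d) (L := L) (suRep N) β)))) P') :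
    TendstoInDistribution (fun (n : ℕ) (x : ℕ → GaugeConfig d L (Matrix.specialUnitaryGroup (Fin N) ℂ)) =>
        (Real.sqrt n)⁻¹ * ∑ t ∈ Finset.range n, (f (x t) - ∫ z, f z ∂(wilsonMeasure (d := d) (L := L) (suRep N) β)))
      atTop Y (fun _ => (Kernel.trajMeasure (X := fun _ : ℕ => GaugeConfig d L (Matrix.specialUnitaryGroup (Fin N) ℂ)) μ₀
              (fun t : ℕ => (cmORSweep sched ∘ₖ
                latSweep (gibbsDensity fun U : GaugeConfig d L (Matrix.specialUnitaryGroup (Fin N) ℂ) => β * wilsonAction (suRep N) U) frames links).comap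
                (fun h : (i : ↥(Finset.Iic t)) → GaugeConfig d L (Matrix.specialUnitaryGroup (Fin N) ℂ) =>
                  h ⟨t, Finset.mem_Iic.2 le_rfl⟩) (measurable_pi_apply _)))) P' := by
  haveI : IsProbabilityMeasure (wilsonMeasure (d := d) (L := L) (suRep N) β) := isProbabilityMeasure_wilsonMeasure _ continuous_suRep β
  obtain ⟨hinv, ε', hε0, -, hmin⟩ := wilson_cmSweep_orSweep_certificate N (d := d) hL β frames hlex hl sched
  exact GeneralNCMC.tendstoInDistribution_timeAverage_of_nHit hinv hε0.ne' hmin Nat.one_pos hf hC μ₀ hY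

/-- **BATCH MEANS ESTIMATE `σ²_f` CONSISTENTLY ALONG THE `'hb' + n_or × 'or'` COMPOSITE, FROM EVERY INITIAL LAW**:
`a b · SE²_BM → σ²_f` in probability as `a, b → ∞`. -/
theorem wilson_cmSweep_orSweep_batchMeans_tendstoInMeasure [NeZero L] (hL : 2 ≤ L) (β : ℝ) (frames : List (Fin N ≃ Fin 2 ⊕ m))
    (hlex : frames.map pairOf = lexPairs (Finset.univ.sort (· ≤ ·) : List (Fin N)) ∨
      frames.map pairOf = (lexPairs (Finset.univ.sort (· ≤ ·) : List (Fin N))).reverse)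
    {links : List (Edge d L)} (hl : ∀ e, e ∈ links) (sched : List (Edge d L × (Fin N ≃ Fin 2 ⊕ m)))
    [IsMarkovKernel (latSweep (gibbsDensity fun U : GaugeConfig d L (Matrix.specialUnitaryGroup (Fin N) ℂ) => β * wilsonAction (suRep N) U) frames links)]
    {f : GaugeConfig d L (Matrix.specialUnitaryGroup (Fin N) ℂ) → ℝ} (hf : Measurable f) {C : ℝ} (hC : ∀ U, |f U| ≤ C)
    (μ₀ : Measure (GaugeConfig d L (Matrix.specialUnitaryGroup (Fin N) ℂ))) [IsProbabilityMeasure μ₀]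
    {a b' : ℕ → ℕ} (ha : Tendsto a atTop atTop) (hb' : Tendsto b' atTop atTop) :
    TendstoInMeasure (Kernel.trajMeasure (X := fun _ : ℕ => GaugeConfig d L (Matrix.specialUnitaryGroup (Fin N) ℂ)) μ₀
              (fun t : ℕ => (cmORSweep sched ∘ₖ
                latSweep (gibbsDensity fun U : GaugeConfig d L (Matrix.specialUnitaryGroup (Fin N) ℂ) => β * wilsonAction (suRep N) U) frames links).comap
                (fun h : (i : ↥(Finset.Iic t)) → GaugeConfig d L (Matrix.specialUnitaryGroup (Fin N) ℂ) =>
                  h ⟨t, Finset.mem_Iic.2 le_rfl⟩) (measurable_pi_apply _)))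
      (fun (n : ℕ) (x : ℕ → GaugeConfig d L (Matrix.specialUnitaryGroup (Fin N) ℂ)) => ((b' n * a n : ℕ) : ℝ)
        * replicaSEsq (fun j (x : ℕ → GaugeConfig d L (Matrix.specialUnitaryGroup (Fin N) ℂ)) =>
            (∑ i ∈ Finset.range (b' n), f (x (b' n * j + i))) / (b' n)) (a n) x)
      atTop (fun _ => (∫ y, (f y - ∫ z, f z ∂(wilsonMeasure (d := d) (L := L) (suRep N) β)) ^ 2 ∂(wilsonMeasure (d := d) (L := L) (suRep N) β))
              + 2 * ∑' k, ∫ y, (f y - ∫ z, f z ∂(wilsonMeasure (d := d) (L := L) (suRep N) β))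
                * (kop (cmORSweep sched ∘ₖ
                latSweep (gibbsDensity fun U : GaugeConfig d L (Matrix.specialUnitaryGroup (Fin N) ℂ) => β * wilsonAction (suRep N) U) frames links))^[k + 1]
                  (fun y => f y - ∫ z, f z ∂(wilsonMeasure (d := d) (L := L) (suRep N) β)) y ∂(wilsonMeasure (d := d) (L := L) (suRep N) β)) := by
  haveI : IsProbabilityMeasure (wilsonMeasure (d := d) (L := L) (suRep N) β) := isProbabilityMeasure_wilsonMeasure _ continuous_suRep β
  obtain ⟨hinv, ε', hε0, hε1, hmin⟩ := wilson_cmSweep_orSweep_certificate N (d := d) hL β frames hlex hl sched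
  exact Scoring.chain_batchMeans_sigmaHat_tendstoInMeasure_of_nHit hinv (GeneralNCMC.minorised_setwise hmin)
    hε0 hε1 Nat.one_pos hf hC μ₀ ha hb'

/-- **THE BATCH-MEANS INTERVAL OF A `'hb' + n_or × 'or'` RUN IS ASYMPTOTICALLY EXACT** (`σ²_f > 0`, `a, b → ∞`,
any initial law, `z > 0`): `P_{μ₀}(|√(ab) (f̄_{ab} − π f)| ≤ z σ̂_BM) → (gaussianReal 0 1)[−z, z]`. -/
theorem wilson_cmSweep_orSweep_batchMeans_coverage [NeZero L] (hL : 2 ≤ L) (β : ℝ) (frames : List (Fin N ≃ Fin 2 ⊕ m))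
    (hlex : frames.map pairOf = lexPairs (Finset.univ.sort (· ≤ ·) : List (Fin N)) ∨
      frames.map pairOf = (lexPairs (Finset.univ.sort (· ≤ ·) : List (Fin N))).reverse)
    {links : List (Edge d L)} (hl : ∀ e, e ∈ links) (sched : List (Edge d L × (Fin N ≃ Fin 2 ⊕ m)))
    [IsMarkovKernel (latSweep (gibbsDensity fun U : GaugeConfig d L (Matrix.specialUnitaryGroup (Fin N) ℂ) => β * wilsonAction (suRep N) U) frames links)]
    {f : GaugeConfig d L (Matrix.specialUnitaryGroup (Fin N) ℂ) → ℝ} (hf : Measurable f) {C : ℝ} (hC : ∀ U, |f U| ≤ C)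
    (hσ : 0 < (∫ y, (f y - ∫ z, f z ∂(wilsonMeasure (d := d) (L := L) (suRep N) β)) ^ 2 ∂(wilsonMeasure (d := d) (L := L) (suRep N) β))
              + 2 * ∑' k, ∫ y, (f y - ∫ z, f z ∂(wilsonMeasure (d := d) (L := L) (suRep N) β))
                * (kop (cmORSweep sched ∘ₖ
                latSweep (gibbsDensity fun U : GaugeConfig d L (Matrix.specialUnitaryGroup (Fin N) ℂ) => β * wilsonAction (suRep N) U) frames links))^[k + 1]
                  (fun y => f y - ∫ z, f z ∂(wilsonMeasure (d := d) (L := L) (suRep N) β)) y ∂(wilsonMeasure (d := d) (L := L) (suRep N) β))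
    (μ₀ : Measure (GaugeConfig d L (Matrix.specialUnitaryGroup (Fin N) ℂ))) [IsProbabilityMeasure μ₀]
    {a b' : ℕ → ℕ} (ha : Tendsto a atTop atTop) (hb' : Tendsto b' atTop atTop) {z : ℝ} (hz : 0 < z) :
    Tendsto (fun n : ℕ => (Kernel.trajMeasure (X := fun _ : ℕ => GaugeConfig d L (Matrix.specialUnitaryGroup (Fin N) ℂ)) μ₀
              (fun t : ℕ => (cmORSweep sched ∘ₖ
                latSweep (gibbsDensity fun U : GaugeConfig d L (Matrix.specialUnitaryGroup (Fin N) ℂ) => β * wilsonAction (suRep N) U) frames links).comap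
                (fun h : (i : ↥(Finset.Iic t)) → GaugeConfig d L (Matrix.specialUnitaryGroup (Fin N) ℂ) =>
                  h ⟨t, Finset.mem_Iic.2 le_rfl⟩) (measurable_pi_apply _))).real
      {x | |((Real.sqrt ((b' n * a n : ℕ) : ℝ))⁻¹
          * ∑ t ∈ Finset.range (b' n * a n), (f (x t) - ∫ z, f z ∂(wilsonMeasure (d := d) (L := L) (suRep N) β)))
        / Real.sqrt (((b' n * a n : ℕ) : ℝ)
          * replicaSEsq (fun j (x : ℕ → GaugeConfig d L (Matrix.specialUnitaryGroup (Fin N) ℂ)) =>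
              (∑ i ∈ Finset.range (b' n), f (x (b' n * j + i))) / (b' n)) (a n) x)| ≤ z})
      atTop (𝓝 ((gaussianReal 0 1).real (Set.Icc (-z) z))) := by
  haveI : IsProbabilityMeasure (wilsonMeasure (d := d) (L := L) (suRep N) β) := isProbabilityMeasure_wilsonMeasure _ continuous_suRep β
  obtain ⟨hinv, ε', hε0, hε1, hmin⟩ := wilson_cmSweep_orSweep_certificate N (d := d) hL β frames hlex hl sched
  exact Scoring.doeblinPower_batchMeans_studentized_coverage hinv hmin hε0 hε1 Nat.one_pos hf hC hσ μ₀ ha hb' hz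

/-- **THE REPORTED `τ̂_int = σ̂²_BM/(2 v̂)` OF A `'hb' + n_or × 'or'` RUN IS CONSISTENT** (`Var_π f ≠ 0`, `a, b → ∞`,
any initial law): `σ̂²/(2 v̂) → τ_int(ρ_f) = 1/2 + Σ_{t≥1} ρ_f(t)` in probability. -/
theorem wilson_cmSweep_orSweep_tauInt_tendstoInMeasure [NeZero L] (hL : 2 ≤ L) (β : ℝ) (frames : List (Fin N ≃ Fin 2 ⊕ m))
    (hlex : frames.map pairOf = lexPairs (Finset.univ.sort (· ≤ ·) : List (Fin N)) ∨
      frames.map pairOf = (lexPairs (Finset.univ.sort (· ≤ ·) : List (Fin N))).reverse)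
    {links : List (Edge d L)} (hl : ∀ e, e ∈ links) (sched : List (Edge d L × (Fin N ≃ Fin 2 ⊕ m)))
    [IsMarkovKernel (latSweep (gibbsDensity fun U : GaugeConfig d L (Matrix.specialUnitaryGroup (Fin N) ℂ) => β * wilsonAction (suRep N) U) frames links)]
    {f : GaugeConfig d L (Matrix.specialUnitaryGroup (Fin N) ℂ) → ℝ} (hf : Measurable f) {C : ℝ} (hC : ∀ U, |f U| ≤ C)
    (hvar : autocov (cmORSweep sched ∘ₖ
                latSweep (gibbsDensity fun U : GaugeConfig d L (Matrix.specialUnitaryGroup (Fin N) ℂ) => β * wilsonAction (suRep N) U) frames links)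
        (wilsonMeasure (d := d) (L := L) (suRep N) β) (fun y => f y - ∫ z, f z ∂(wilsonMeasure (d := d) (L := L) (suRep N) β)) 0 ≠ 0)
    (μ₀ : Measure (GaugeConfig d L (Matrix.specialUnitaryGroup (Fin N) ℂ))) [IsProbabilityMeasure μ₀]
    {a b' : ℕ → ℕ} (ha : Tendsto a atTop atTop) (hb' : Tendsto b' atTop atTop) :
    TendstoInMeasure (Kernel.trajMeasure (X := fun _ : ℕ => GaugeConfig d L (Matrix.specialUnitaryGroup (Fin N) ℂ)) μ₀
              (fun t : ℕ => (cmORSweep sched ∘ₖ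
                latSweep (gibbsDensity fun U : GaugeConfig d L (Matrix.specialUnitaryGroup (Fin N) ℂ) => β * wilsonAction (suRep N) U) frames links).comap
                (fun h : (i : ↥(Finset.Iic t)) → GaugeConfig d L (Matrix.specialUnitaryGroup (Fin N) ℂ) =>
                  h ⟨t, Finset.mem_Iic.2 le_rfl⟩) (measurable_pi_apply _)))
      (fun (n : ℕ) (x : ℕ → GaugeConfig d L (Matrix.specialUnitaryGroup (Fin N) ℂ)) =>
        (((b' n * a n : ℕ) : ℝ)
          * replicaSEsq (fun j (x : ℕ → GaugeConfig d L (Matrix.specialUnitaryGroup (Fin N) ℂ)) =>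
              (∑ i ∈ Finset.range (b' n), f (x (b' n * j + i))) / (b' n)) (a n) x)
        / (2 * ((∑ t ∈ Finset.range (b' n * a n), f (x t) ^ 2) / ((b' n * a n : ℕ) : ℝ)
            - ((∑ t ∈ Finset.range (b' n * a n), f (x t)) / ((b' n * a n : ℕ) : ℝ)) ^ 2)))
      atTop (fun _ => tauInt (fun t =>
        autocov (cmORSweep sched ∘ₖ
                latSweep (gibbsDensity fun U : GaugeConfig d L (Matrix.specialUnitaryGroup (Fin N) ℂ) => β * wilsonAction (suRep N) U) frames links)
            (wilsonMeasure (d := d) (L := L) (suRep N) β) (fun y => f y - ∫ z, f z ∂(wilsonMeasure (d := d) (L := L) (suRep N) β)) t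
          / autocov (cmORSweep sched ∘ₖ
                latSweep (gibbsDensity fun U : GaugeConfig d L (Matrix.specialUnitaryGroup (Fin N) ℂ) => β * wilsonAction (suRep N) U) frames links)
            (wilsonMeasure (d := d) (L := L) (suRep N) β) (fun y => f y - ∫ z, f z ∂(wilsonMeasure (d := d) (L := L) (suRep N) β)) 0)) := by
  haveI : IsProbabilityMeasure (wilsonMeasure (d := d) (L := L) (suRep N) β) := isProbabilityMeasure_wilsonMeasure _ continuous_suRep β
  obtain ⟨hinv, ε', hε0, hε1, hmin⟩ := wilson_cmSweep_orSweep_certificate N (d := d) hL β frames hlex hl sched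
  exact Scoring.chain_batchMeans_tauInt_tendstoInMeasure_of_nHit hinv hmin hε0 hε1 Nat.one_pos hf hC hvar μ₀ ha hb'

end CMOR

end Summit.Ventures.LatticeQCDFlow.Exactness

end
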